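import Summits.BirchSwinnertonDyer.Rank1Residual.Additive.KodairaDictionaryThree
import Summits.BirchSwinnertonDyer.Rank1Residual.Additive.SemistabilityDefectRamification
import Summits.BirchSwinnertonDyer.BirchSwinnertonDyer.Theorems.TameQuarticSolventSolventPairLowerBoundSupersingular
import Mathlib.NumberTheory.RamificationInertia.Basic
import HarnessLib

/-!
# Route `TameQuarticSolvent`, child crux `LowerBSD3OverSolventQuartic` (stmt-BirchSwinnertonDyer-23963) of
# `SolventPairLowerBound` (stmt-BirchSwinnertonDyer-21391): the RAMIFICATION CERTIFICATE of the good-reduction base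
# — a (t′)-at-`3` curve is good above `3` only where `4 ∣ e(w∣3)`; no base of degree `< 4`; over a quartic the
# ramification index IS `4`

HONEST FRAMING. Theorems only (no definition, no named fact, nothing asserted); a helper `--supports` the child
item 23963 `LowerBSD3OverSolventQuartic` (K1⁻ of line `birth`), which stays OPEN — it is a research statement
(lower half of BSD₃ for `E_M` over a totally real quartic `M` at a place `w ∣ 3` with `e(w∣3) = 4`; lead g4's memo
`Cruxes/SolventPairLowerBound/LEAD-g4-21391.md` §1–§2). BSD is not proved by any of this. No route file is imported.

WHAT THIS FILE RECORDS, in the kernel and in 23963's own currency (`w.asIdeal.ramificationIdx ℤ`), is WHY the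
child's base cannot be made smaller — the «wall certificate» of lead g4 (folder-only there), asked for by the
route pen (bsd-wall STATUS 2026-08-28T00:24:03Z (1)):

* `semistabilityIndex_three_eq_four_of_subTprime` — on the census cell (t′) at `3` (`Addv W 3`, `SubTprime W 3`,
  i.e. Kodaira `III`/`III*`, tree `subTprime_three_iff_kodairaSymbolAt_III_or_IIIstar`) the semistability index is
  `e_E(3) = 12 / gcd(12, ord₃ Δ_min) = 4` (`ord₃ Δ_min ∈ {3, 9}`, Tate's algorithm, tree
  `ordMinimalDiscriminant_eq_numComponentsAt_add_one_of_kodairaSymbolAt`).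
* `four_dvd_ramificationIdx_of_hasGoodReductionAt` — for EVERY number field `F` and EVERY place `w ∋ 3` at which
  `E_F` has good reduction, `4 ∣ e(w∣3)` (tree `semistabilityIndex_dvd_ramificationIdx_of_hasGoodReductionAt`,
  Silverman *AEC* VII.1.3 + Mathlib `valuation_liesOver`; Serre–Tate in valuation form); hence
  `not_ramificationIdx_dvd_two_of_hasGoodReductionAt` (`e(w∣3) ∉ {1, 2}`: no unramified and no quadratic good base —
  the exact hypothesis «`e < p`» / «`e ∣ p − 1`» of every printed signed or semistabilised Iwasawa theory at `p = 3`
  is unmeetable on the whole leaf) and `four_le_finrank_of_hasGoodReductionAt` (`[F:ℚ] ≥ 4`, Mathlib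
  `Ideal.ramificationIdx_le_finrank`): `not_hasGoodReductionAt_of_finrank_lt_four`.
* `ramificationIdx_eq_four_of_hasGoodReductionAt_of_finrank_eq_four` — over a QUARTIC field `M` good reduction at
  `w ∋ 3` forces `e(w∣3) = 4` on the nose; in the child's binders (`[K:ℚ] = 2`, `[M:K] = 2`):
  `ramificationIdx_eq_four_of_hasGoodReductionAt_quadratic_tower` — so 23963's hypothesis «`∀ w ∣ 3, e(w∣3) = 4`»
  is IMPLIED by its hypothesis «`∀ w ∣ 3, E_M good at w`» (a redundant binder; recorded, no re-text asked).
* `eq_of_hasGoodReductionAt_of_finrank_eq_four`, `frobeniusTraceAt_eq_zero_of_hasGoodReductionAt_of_finrank_eq_four`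
  — over a quartic good base the place above `3` is UNIQUE (`3` totally ramified: `∑ e f = 4` with one term `4 · 1`,
  Mathlib `Ideal.sum_ramification_inertia_eq_finrank`) and the reduction there is SUPERSINGULAR with `a_w = 0`,
  `#Ẽ_w(𝔽₃) = 4` (tree `frobeniusTraceAt_baseChange_eq_zero_of_subTprime_of_finrank_eq_four`, its `e = 4` binder
  now discharged); tower form `supersingular_of_hasGoodReductionAt_quadratic_tower`.

References: J. H. Silverman, *AEC* VII.1 Prop. 1.3, VII.5.1; J.-P. Serre, J. Tate, Ann. of Math. 88 (1968) §2
Cor. 2–3; J. H. Silverman, *ATAEC* IV.9.4 and Table 4.1 (`p = 3`).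
-/

-- D-0017: single-problem summit, so `Summit.BirchSwinnertonDyer.BirchSwinnertonDyer.…` repeats a namespace BY DESIGN.
set_option linter.dupNamespace false

noncomputable section

open scoped NumberField

open IsDedekindDomain IsDedekindDomain.HeightOneSpectrum NumberField WeierstrassCurve
  Literature.NumberTheory.EllipticCurves Literature.NumberTheory.EllipticCurves.Rank1Residual
  Literature.NumberTheory.DiophantineGeometry
  Summit.BirchSwinnertonDyer.Rank1Residual.Additive

namespace Summit.BirchSwinnertonDyer.BirchSwinnertonDyer.Theorems.LowerBSD3OverSolventQuartic

variable (W : WeierstrassCurve ℚ) [W.IsElliptic] [W.IsGloballyMinimal]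

/-! ## (t′) at `3` has semistability index `4` -/

/-- **On the cell (t′) at `3` the semistability index is `4`.** For `W/ℚ` elliptic, globally minimal, additive at
`3` (`Addv W 3`) and of census class (t′) (`SubTprime W 3`): `semistabilityIndex W 3 = 4`. The cell is Kodaira
`III`/`III*` (`subTprime_three_iff_kodairaSymbolAt_III_or_IIIstar`), where Tate's algorithm gives
`ord₃ Δ_min = m + 1 ∈ {3, 9}` (`ordMinimalDiscriminant_eq_numComponentsAt_add_one_of_kodairaSymbolAt`), and
`12 / gcd(12, 3) = 12 / gcd(12, 9) = 4`.
[cite: SilvermanATAEC1994, IV.9.4 Steps 4, 9 and Table 4.1 (p = 3)] -/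
theorem semistabilityIndex_three_eq_four_of_subTprime (hadd : Addv W 3) (hsub : SubTprime W 3) :
    semistabilityIndex W 3 = 4 := by
  haveI : Fact (Nat.Prime 3) := ⟨Nat.prime_three⟩
  have hIII := (subTprime_three_iff_kodairaSymbolAt_III_or_IIIstar W hadd).mp hsub
  haveI : PerfectField (IsLocalRing.ResidueField ((placeOf 3).adicCompletionIntegers ℚ)) :=
    PerfectField.ofFinite
  have h2 : ringChar (ℤ ⧸ (placeOf 3).asIdeal) ≠ 2 := by rw [ringChar_int_quot_placeOf 3]; decide
  have hord := W.ordMinimalDiscriminant_eq_numComponentsAt_add_one_of_kodairaSymbolAt (placeOf 3) h2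
    (hIII.elim Or.inl fun h ↦ Or.inr (Or.inl h))
  rw [ordMinimalDiscriminant_placeOf_eq W 3] at hord
  unfold numComponentsAt at hord
  unfold semistabilityIndex
  rcases hIII with h | h <;> rw [h] at hord <;> simp only [KodairaSymbol.numComponents] at hord <;>
    rw [hord] <;> decide

/-! ## Good reduction above `3` forces `4 ∣ e(w∣3)` -/

section AnyField

variable (F : Type) [Field F] [NumberField F] (w : HeightOneSpectrum (𝓞 F))

/-- Bridge between the two ramification indices of the tree: for a place `w ∋ 3` of a number field `F`,
Mathlib's legacy `(3).ramificationIdx' w` and the item's `w.asIdeal.ramificationIdx ℤ` agree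
(`Ideal.ramificationIdx'_eq_ramificationIdx`, `w` lies over `(3)` by `liesOver_span_of_natCast_mem`). [folklore] -/
theorem ramificationIdx'_span_three_eq (hw : ((3 : ℕ) : 𝓞 F) ∈ w.asIdeal) :
    (Ideal.span {((3 : ℕ) : ℤ)}).ramificationIdx' w.asIdeal = w.asIdeal.ramificationIdx ℤ := by
  haveI : Fact (Nat.Prime 3) := ⟨Nat.prime_three⟩
  haveI := liesOver_span_of_natCast_mem 3 F w hw
  haveI := w.isPrime
  exact Ideal.ramificationIdx'_eq_ramificationIdx _ _ (by
    rw [Ne, Ideal.span_singleton_eq_bot]; exact_mod_cast Nat.prime_three.ne_zero)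

/-- **Good reduction above `3` forces `4 ∣ e(w∣3)` on the cell (t′).** For `W/ℚ` elliptic, globally minimal,
`Addv W 3`, `SubTprime W 3`, ANY number field `F` and ANY place `w ∋ 3` with `E_F` good at `w`:
`4 ∣ w.asIdeal.ramificationIdx ℤ`. (`e_E(3) ∣ e(w∣3)` by `semistabilityIndex_dvd_ramificationIdx_of_hasGoodReductionAt`
— a `w`-minimal model has unit discriminant and `ord_w = e(w∣3) · ord₃` on `ℚ` — and `e_E(3) = 4`.) This is the
valuation-theoretic shadow of Serre–Tate: inertia at `3` acts through a cyclic group of order `4`, which a good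
base must kill. [cite: SilvermanAEC2009, Prop. VII.1.3 and VII.5.1] [cite: SerreTate1968, §2 Cor. 2] -/
theorem four_dvd_ramificationIdx_of_hasGoodReductionAt (hadd : Addv W 3) (hsub : SubTprime W 3)
    (hw : ((3 : ℕ) : 𝓞 F) ∈ w.asIdeal) (hgood : (W.baseChange F).HasGoodReductionAt w) :
    4 ∣ w.asIdeal.ramificationIdx ℤ := by
  haveI : Fact (Nat.Prime 3) := ⟨Nat.prime_three⟩
  have h := semistabilityIndex_dvd_ramificationIdx_of_hasGoodReductionAt W 3 F w hw hgood
  rwa [semistabilityIndex_three_eq_four_of_subTprime W hadd hsub, ramificationIdx'_span_three_eq F w hw] at h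

omit [W.IsElliptic] in
/-- **No good base with `e(w∣3) ∈ {1, 2}`.** On the cell (t′) at `3` (`SubTprime W 3` alone: `e_E(3) ∤ 3 − 1`),
for ANY number field `F` and place `w ∋ 3` with `E_F` good at `w`, the ramification index `e(w∣3)` does NOT divide
`2`: `e_E(3) ∣ e(w∣3) ∣ 2` would contradict `e_E(3) ∤ 2`. In particular the hypotheses «`e < p`» (B. D. Kim),
«unramified» (Lei–Loeffler–Zerbes) and «`e_E ∣ p − 1`» (Delbourgo, Kohen–Pacetti) of the printed signed /
semistabilised Iwasawa theories are unmeetable at `p = 3` on the whole leaf.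
[cite: SilvermanAEC2009, Prop. VII.1.3 and VII.5.1] -/
theorem not_ramificationIdx_dvd_two_of_hasGoodReductionAt [W.IsElliptic] (hsub : SubTprime W 3)
    (hw : ((3 : ℕ) : 𝓞 F) ∈ w.asIdeal) (hgood : (W.baseChange F).HasGoodReductionAt w) :
    ¬ w.asIdeal.ramificationIdx ℤ ∣ 2 := by
  haveI : Fact (Nat.Prime 3) := ⟨Nat.prime_three⟩
  obtain ⟨-, -, he⟩ := hsub
  intro h2
  have h := semistabilityIndex_dvd_ramificationIdx_of_hasGoodReductionAt W 3 F w hw hgood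
  rw [ramificationIdx'_span_three_eq F w hw] at h
  exact he (h.trans h2)

/-- **A good base has degree at least `4`.** On the cell (t′) at `3`, if `E_F` is good at some place `w ∋ 3` of
the number field `F`, then `4 ≤ [F:ℚ]` (`4 ∣ e(w∣3)`, `0 < e(w∣3) ≤ [F:ℚ]`, Mathlib `Ideal.ramificationIdx_le_finrank`).
[cite: SilvermanAEC2009, Prop. VII.1.3 and VII.5.1] -/
theorem four_le_finrank_of_hasGoodReductionAt (hadd : Addv W 3) (hsub : SubTprime W 3)
    (hw : ((3 : ℕ) : 𝓞 F) ∈ w.asIdeal) (hgood : (W.baseChange F).HasGoodReductionAt w) :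
    4 ≤ Module.finrank ℚ F := by
  haveI : Fact (Nat.Prime 3) := ⟨Nat.prime_three⟩
  have h4 := four_dvd_ramificationIdx_of_hasGoodReductionAt W F w hadd hsub hw hgood
  haveI := liesOver_span_of_natCast_mem 3 F w hw
  haveI := w.isPrime
  haveI : (Ideal.span {((3 : ℕ) : ℤ)}).IsMaximal :=
    ((Ideal.span_singleton_prime (by exact_mod_cast Nat.prime_three.ne_zero)).mpr
      (Nat.prime_iff_prime_int.mp Nat.prime_three)).isMaximal (by
        rw [Ne, Ideal.span_singleton_eq_bot]; exact_mod_cast Nat.prime_three.ne_zero)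
  have hle : (Ideal.span {((3 : ℕ) : ℤ)}).ramificationIdx' w.asIdeal ≤ Module.finrank ℚ F :=
    Ideal.ramificationIdx_le_finrank (𝓞 F) ℚ F w.asIdeal
  rw [ramificationIdx'_span_three_eq F w hw] at hle
  have hpos : 0 < w.asIdeal.ramificationIdx ℤ := Ideal.ramificationIdx_pos _ _
  exact (Nat.le_of_dvd hpos h4).trans hle

/-- **No good base of degree `< 4`** (in particular: not over `ℚ`, over no quadratic and over no cubic field):
on the cell (t′) at `3`, if `[F:ℚ] < 4` then `E_F` is good at NO place `w ∋ 3`.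
[cite: SilvermanAEC2009, Prop. VII.1.3 and VII.5.1] -/
theorem not_hasGoodReductionAt_of_finrank_lt_four (hadd : Addv W 3) (hsub : SubTprime W 3)
    (hF : Module.finrank ℚ F < 4) (hw : ((3 : ℕ) : 𝓞 F) ∈ w.asIdeal) :
    ¬ (W.baseChange F).HasGoodReductionAt w := fun hgood ↦
  absurd (four_le_finrank_of_hasGoodReductionAt W F w hadd hsub hw hgood) (not_le.mpr hF)

/-- **Over a quartic field the good place above `3` has `e(w∣3) = 4` exactly.** On the cell (t′) at `3`, if
`[M:ℚ] = 4` and `E_M` is good at `w ∋ 3`, then `w.asIdeal.ramificationIdx ℤ = 4` (`4 ∣ e ≤ 4`, `e > 0`).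
[cite: SilvermanAEC2009, Prop. VII.1.3 and VII.5.1] -/
theorem ramificationIdx_eq_four_of_hasGoodReductionAt_of_finrank_eq_four (hadd : Addv W 3)
    (hsub : SubTprime W 3) (hM : Module.finrank ℚ F = 4) (hw : ((3 : ℕ) : 𝓞 F) ∈ w.asIdeal)
    (hgood : (W.baseChange F).HasGoodReductionAt w) :
    w.asIdeal.ramificationIdx ℤ = 4 := by
  haveI : Fact (Nat.Prime 3) := ⟨Nat.prime_three⟩
  have h4 := four_dvd_ramificationIdx_of_hasGoodReductionAt W F w hadd hsub hw hgood
  haveI := liesOver_span_of_natCast_mem 3 F w hw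
  haveI := w.isPrime
  haveI : (Ideal.span {((3 : ℕ) : ℤ)}).IsMaximal :=
    ((Ideal.span_singleton_prime (by exact_mod_cast Nat.prime_three.ne_zero)).mpr
      (Nat.prime_iff_prime_int.mp Nat.prime_three)).isMaximal (by
        rw [Ne, Ideal.span_singleton_eq_bot]; exact_mod_cast Nat.prime_three.ne_zero)
  have hle : (Ideal.span {((3 : ℕ) : ℤ)}).ramificationIdx' w.asIdeal ≤ Module.finrank ℚ F :=
    Ideal.ramificationIdx_le_finrank (𝓞 F) ℚ F w.asIdeal
  rw [ramificationIdx'_span_three_eq F w hw, hM] at hle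
  have hpos : 0 < w.asIdeal.ramificationIdx ℤ := Ideal.ramificationIdx_pos _ _
  obtain ⟨k, hk⟩ := h4
  rw [hk] at hle hpos ⊢
  have hk1 : k = 1 := by omega
  rw [hk1]

/-- **Over a quartic good base the place above `3` is unique** (`3` is totally ramified in `M`). On the cell (t′)
at `3`, if `[M:ℚ] = 4` and `E_M` is good at a place `w ∋ 3`, then `w` is the ONLY place of `M` above `3`: in the
fundamental identity `∑_{w' ∣ 3} e(w'∣3) f(w'∣3) = [M:ℚ] = 4` (Mathlib `Ideal.sum_ramification_inertia_eq_finrank`,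
`RingOfIntegers.rank`) the term of `w` is already `4 · f(w∣3) ≥ 4`, so no second term `≥ 1` fits. [folklore] -/
theorem eq_of_hasGoodReductionAt_of_finrank_eq_four (hadd : Addv W 3) (hsub : SubTprime W 3)
    (hM : Module.finrank ℚ F = 4) (hw : ((3 : ℕ) : 𝓞 F) ∈ w.asIdeal)
    (hgood : (W.baseChange F).HasGoodReductionAt w) (w' : HeightOneSpectrum (𝓞 F))
    (hw' : ((3 : ℕ) : 𝓞 F) ∈ w'.asIdeal) : w' = w := by
  classical
  have he := ramificationIdx_eq_four_of_hasGoodReductionAt_of_finrank_eq_four W F w hadd hsub hM hw hgood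
  by_contra hne
  have hne' : w'.asIdeal ≠ w.asIdeal := fun h ↦ hne (HeightOneSpectrum.ext h)
  haveI : Fact (Nat.Prime 3) := ⟨Nat.prime_three⟩
  set P : Ideal ℤ := Ideal.span {((3 : ℕ) : ℤ)} with hP
  haveI : w.asIdeal.LiesOver P := liesOver_span_of_natCast_mem 3 F w hw
  haveI : w'.asIdeal.LiesOver P := liesOver_span_of_natCast_mem 3 F w' hw'
  haveI : P.IsPrime := (Ideal.span_singleton_prime (by exact_mod_cast Nat.prime_three.ne_zero)).mpr
    (Nat.prime_iff_prime_int.mp Nat.prime_three)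
  haveI : P.IsMaximal := Ideal.IsPrime.isMaximal inferInstance (by
    rw [hP, Ne, Ideal.span_singleton_eq_bot]; exact_mod_cast Nat.prime_three.ne_zero)
  haveI := w.isPrime
  haveI := w'.isPrime
  haveI := w'.isMaximal
  haveI : Finite (P.primesOver (𝓞 F)) := (Algebra.QuasiFinite.finite_primesOver P).to_subtype
  letI := Fintype.ofFinite (P.primesOver (𝓞 F))
  have hsum := Ideal.sum_ramification_inertia_eq_finrank P (𝓞 F)
  rw [RingOfIntegers.rank, hM] at hsum
  set a : P.primesOver (𝓞 F) := ⟨w.asIdeal, inferInstance, inferInstance⟩ with ha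
  set b : P.primesOver (𝓞 F) := ⟨w'.asIdeal, inferInstance, inferInstance⟩ with hb
  have hab : a ≠ b := fun h ↦ hne' (congrArg Subtype.val h).symm
  set g : P.primesOver (𝓞 F) → ℕ := fun q ↦ q.1.ramificationIdx ℤ * q.1.inertiaDeg ℤ with hg
  have hpair : g a + g b ≤ ∑ q : P.primesOver (𝓞 F), g q := by
    rw [← Finset.sum_pair hab]
    exact Finset.sum_le_sum_of_subset (Finset.subset_univ _)
  -- the `w`-term is `4 · f(w∣3) ≥ 4`, the `w'`-term is `≥ 1`
  have hfa : w.asIdeal.inertiaDeg ℤ ≠ 0 := by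
    rw [← Ideal.inertiaDeg'_eq_inertiaDeg P w.asIdeal]; exact Ideal.inertiaDeg'_ne_zero _ _
  have hfb : w'.asIdeal.inertiaDeg ℤ ≠ 0 := by
    rw [← Ideal.inertiaDeg'_eq_inertiaDeg P w'.asIdeal]; exact Ideal.inertiaDeg'_ne_zero _ _
  have heb : 0 < w'.asIdeal.ramificationIdx ℤ := Ideal.ramificationIdx_pos _ _
  have hga : 4 ≤ g a := by
    show 4 ≤ w.asIdeal.ramificationIdx ℤ * w.asIdeal.inertiaDeg ℤ
    rw [he]; exact Nat.le_mul_of_pos_right 4 (Nat.pos_of_ne_zero hfa)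
  have hgb : 1 ≤ g b := by
    show 1 ≤ w'.asIdeal.ramificationIdx ℤ * w'.asIdeal.inertiaDeg ℤ
    exact Nat.one_le_iff_ne_zero.mpr (Nat.mul_ne_zero heb.ne' hfb)
  have : ∑ q : P.primesOver (𝓞 F), g q = 4 := hsum
  omega

/-- **Over a quartic good base the reduction above `3` is supersingular with `a_w = 0`, `#Ẽ_w(𝔽₃) = 4`.** On the
cell (t′) at `3`, if `[M:ℚ] = 4` and `E_M` is good at `w ∋ 3`, then `a_w(E_M) = 0` and the reduction has exactly
`4` rational points over the residue field `𝔽₃` (`e(w∣3) = 4` by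
`ramificationIdx_eq_four_of_hasGoodReductionAt_of_finrank_eq_four`, then the tree's
`frobeniusTraceAt_baseChange_eq_zero_of_subTprime_of_finrank_eq_four`: `f(w∣3) = 1` and the (t′) medium model
reduces to `y² = x³ + c x` over `𝔽₃`). [cite: SilvermanAEC2009, C.§16] [cite: SerreTate1968, §2 Cor. 2] -/
theorem frobeniusTraceAt_eq_zero_of_hasGoodReductionAt_of_finrank_eq_four (hadd : Addv W 3)
    (hsub : SubTprime W 3) (hM : Module.finrank ℚ F = 4) (hw : ((3 : ℕ) : 𝓞 F) ∈ w.asIdeal)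
    (hgood : (W.baseChange F).HasGoodReductionAt w) :
    (W.baseChange F).frobeniusTraceAt w = 0 ∧
      Nat.card ((W.baseChange F).reductionAt w).toAffine.Point = 4 :=
  SolventPairLowerBound.frobeniusTraceAt_baseChange_eq_zero_of_subTprime_of_finrank_eq_four W hadd hsub F hM w
    hw (ramificationIdx_eq_four_of_hasGoodReductionAt_of_finrank_eq_four W F w hadd hsub hM hw hgood)

end AnyField

/-! ## In the child's binders: `[K:ℚ] = 2`, `[M:K] = 2` -/

/-- **23963's ramification hypothesis is implied by its good-reduction hypothesis.** In the binders of the child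
item `LowerBSD3OverSolventQuartic` — `K ⊂ M` number fields with `Module.finrank ℚ K = 2`, `Module.finrank K M = 2`
(so `[M:ℚ] = 4`, `Module.finrank_mul_finrank`) — on the cell (t′) at `3`: if `E_M` is good at every place
`w ∋ 3` of `M`, then every such place has `w.asIdeal.ramificationIdx ℤ = 4`. (So the binder
«`∀ w ∋ 3, e(w∣3) = 4`» of 23963 is redundant next to «`∀ w ∋ 3, E_M good at w`»; recorded for the pen, the item
text is not touched.) [cite: SilvermanAEC2009, Prop. VII.1.3 and VII.5.1] -/
theorem ramificationIdx_eq_four_of_hasGoodReductionAt_quadratic_tower (hadd : Addv W 3)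
    (hsub : SubTprime W 3) (K : Type) [Field K] [NumberField K] (M : Type) [Field M] [NumberField M]
    [Algebra K M] (hK : Module.finrank ℚ K = 2) (hKM : Module.finrank K M = 2)
    (hgood : ∀ w : HeightOneSpectrum (𝓞 M), ((3 : ℕ) : 𝓞 M) ∈ w.asIdeal →
      (W.baseChange M).HasGoodReductionAt w) :
    ∀ w : HeightOneSpectrum (𝓞 M), ((3 : ℕ) : 𝓞 M) ∈ w.asIdeal → w.asIdeal.ramificationIdx ℤ = 4 := by
  intro w hw
  -- `ℚ → K → M` is a scalar tower for the canonical `ℚ`-algebra structures (characteristic zero)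
  letI : Algebra ℚ M := inferInstance
  haveI : IsScalarTower ℚ K M := IsScalarTower.of_algebraMap_eq' (Subsingleton.elim _ _)
  haveI : Module.Free K M := Module.Free.of_divisionRing K M
  haveI : Module.Finite ℚ K := inferInstance
  have hM : Module.finrank ℚ M = 4 := by
    rw [← Module.finrank_mul_finrank ℚ K M, hK, hKM]
  exact ramificationIdx_eq_four_of_hasGoodReductionAt_of_finrank_eq_four W M w hadd hsub hM hw (hgood w hw)

/-- **The local picture above `3` in the child's binders.** `K ⊂ M`, `[K:ℚ] = 2`, `[M:K] = 2`, `W` on the cell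
(t′) at `3`, `E_M` good at every place above `3`: then at every `w ∋ 3` of `M` one has `e(w∣3) = 4`, `a_w(E_M) = 0`
and `#Ẽ_w(𝔽₃) = 4`, and there is only one such `w` (`eq_of_hasGoodReductionAt_of_finrank_eq_four`) — the
«good supersingular reduction over the totally ramified quartic place» of the item's informal text, with no
ramification binder. [cite: SilvermanAEC2009, C.§16] [cite: SerreTate1968, §2 Cor. 2] -/
theorem supersingular_of_hasGoodReductionAt_quadratic_tower (hadd : Addv W 3) (hsub : SubTprime W 3)
    (K : Type) [Field K] [NumberField K] (M : Type) [Field M] [NumberField M] [Algebra K M]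
    (hK : Module.finrank ℚ K = 2) (hKM : Module.finrank K M = 2)
    (hgood : ∀ w : HeightOneSpectrum (𝓞 M), ((3 : ℕ) : 𝓞 M) ∈ w.asIdeal →
      (W.baseChange M).HasGoodReductionAt w) :
    ∀ w : HeightOneSpectrum (𝓞 M), ((3 : ℕ) : 𝓞 M) ∈ w.asIdeal →
      w.asIdeal.ramificationIdx ℤ = 4 ∧ (W.baseChange M).frobeniusTraceAt w = 0 ∧
        Nat.card ((W.baseChange M).reductionAt w).toAffine.Point = 4 ∧
        ∀ w' : HeightOneSpectrum (𝓞 M), ((3 : ℕ) : 𝓞 M) ∈ w'.asIdeal → w' = w := by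
  intro w hw
  letI : Algebra ℚ M := inferInstance
  haveI : IsScalarTower ℚ K M := IsScalarTower.of_algebraMap_eq' (Subsingleton.elim _ _)
  haveI : Module.Free K M := Module.Free.of_divisionRing K M
  have hM : Module.finrank ℚ M = 4 := by
    rw [← Module.finrank_mul_finrank ℚ K M, hK, hKM]
  obtain ⟨ha, hcard⟩ :=
    frobeniusTraceAt_eq_zero_of_hasGoodReductionAt_of_finrank_eq_four W M w hadd hsub hM hw (hgood w hw)
  exact ⟨ramificationIdx_eq_four_of_hasGoodReductionAt_of_finrank_eq_four W M w hadd hsub hM hw (hgood w hw),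
    ha, hcard, eq_of_hasGoodReductionAt_of_finrank_eq_four W M w hadd hsub hM hw (hgood w hw)⟩

end Summit.BirchSwinnertonDyer.BirchSwinnertonDyer.Theorems.LowerBSD3OverSolventQuartic

end
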